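import Mathlib
import Literature.NumberTheory.LFunctions.Zhang2022.Section15KappaTilde1Analytic
import Literature.NumberTheory.LFunctions.Zhang2022.ToolkitEulerWeightPolylog
import Literature.NumberTheory.LFunctions.Zhang2022.ToolkitSmallPrimeFactorSums
import HarnessLib

/-!
# Zhang (2022) §15 (15.9): the `κ̃₁` majorant is polylogarithmic — `Σ_{h∈𝔫(d₁)} τ₃(h)h^{−σ} ≤ exp(O(log log))`

Topic `Literature/NumberTheory/LFunctions/Zhang2022` (Landau–Siegel audit tree; verdict-neutral; ZHANG-L discharge
lane, helper under the v19 leaf `Typed.Section15B.Eq15_17` through `Z22:§15.u021`). Y. Zhang, *Discrete mean estimates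
and the Landau–Siegel zero*, arXiv:2211.02515v1 (2022) [Zhang2022LandauSiegel] — **an unrefereed manuscript under
adjudication**; nothing here asserts its Theorems 1–2.

`Zhang2022/Section15KappaTilde1Analytic.lean` (zl-libA-p4) bounds `‖κ̃₁(d₁;r,s)‖ ≤ τ₃(d₁)·Σ_{h∈𝔫(d₁)} τ₃(h)h^{−σ₀}`
for `Re s ≥ σ₀ > 0`; the `DeltaContourShift` instance for §15.u021 needs this sup-bound to be `τ₃(d₁)` times a
POLYLOGARITHMIC factor on the contour region `σ ≥ 1 − 1/(16𝓛)`. Here (Part A1 of the u021 instance, zl-w15-plan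
cut 2026-08-27):

* `tau_three_prime_pow` — `τ₃(q^e) = C(e+2,2)` (with the tree's `MeanSquareMajorant.tau_two_prime_pow`); `hasSum_tau_three_prime_pow` — `Σ_e τ₃(q^e)q^{−eσ} = (1 − q^{−σ})⁻³`;
* `tsum_indicator_factoredNumbers_tau_three_le` — `Σ_{h∈𝔫(S)} τ₃(h)h^{−σ} ≤ ∏_{q∈S prime}(1 + 124·q^{−σ})` for
  `σ ≥ 1/2` (Euler product, Mathlib `EulerProduct.summable_and_hasSum_factoredNumbers_prod_filter_prime_tsum`, and
  `(1−x)⁻³ ≤ 1 + 124x` on `[0, 0.71] ∋ q^{−σ}`);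
* `norm_kappaTilde1_le_exp` — for `L ≥ 1`, `log d₁ ≤ 3L⁹`, `Re s ≥ 1 − 1/(16L)`:
  `‖κ̃₁(d₁;r,s)‖ ≤ τ₃(d₁)·exp(124·(e(log 16L + 4) + 1))` (the tree's Euler-weight bound
  `EulerWeightPolylog.prod_primeFactors_one_add_mul_rpow_neg_le`, zl-w16-p1).

## References

* Y. Zhang, arXiv:2211.02515v1 (2022), §15 (15.9)–(15.10) p. 82, §16 p. 90. [cite: Zhang2022LandauSiegel, §15 (15.9) p. 82]
-/

noncomputable section

open Complex Real

namespace Literature.NumberTheory.LFunctions.Zhang2022.Typed.Section15A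

open Literature.NumberTheory.LFunctions.Zhang2022.Skeleton
open Literature.NumberTheory.LFunctions.Zhang2022.MeanSquareMajorant (tau)

/-! ## `τ_j` on prime powers -/

/-- `τ_{j+1}(q^e) = Σ_{i≤e} τ_j(q^i)` (the divisors of `q^e`). [cite: Ivic1985, §1.6, p. 31 (recursion for d_k)] -/
theorem tau_succ_prime_pow (j : ℕ) {q : ℕ} (hq : q.Prime) (e : ℕ) :
    tau (j + 1) (q ^ e) = ∑ i ∈ Finset.range (e + 1), tau j (q ^ i) := by
  rw [MeanSquareMajorant.tau_succ_apply, Nat.sum_divisors_prime_pow hq]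

/-- `τ₃(q^e) = C(e+2, 2)` (`= Σ_{i≤e}(i+1)`, Pascal). [cite: Ivic1985, §1.6, p. 31 (recursion for d_k)] -/
theorem tau_three_prime_pow {q : ℕ} (hq : q.Prime) (e : ℕ) :
    tau 3 (q ^ e) = (((e + 2).choose 2 : ℕ) : ℝ) := by
  rw [show (3 : ℕ) = 2 + 1 from rfl, tau_succ_prime_pow 2 hq e]
  induction e with
  | zero => simp [MeanSquareMajorant.tau_two_prime_pow hq]
  | succ e ih =>
    rw [Finset.sum_range_succ, ih, MeanSquareMajorant.tau_two_prime_pow hq,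
      show e + 1 + 2 = (e + 2) + 1 from by ring, Nat.choose_succ_succ (e + 2) 1, Nat.choose_one_right]
    push_cast
    ring

/-! ## The local factor `Σ_e τ₃(q^e)q^{−eσ} = (1 − q^{−σ})⁻³` and its linear majorant -/

/-- For a prime `q` and `σ > 0`: `Σ_e τ₃(q^e)(q^e)^{−σ} = (1 − q^{−σ})⁻³` (Mathlib's
`hasSum_choose_mul_geometric_of_norm_lt_one`, `k = 2`). [cite: Ivic1985, §1.6 (1.68), p. 30] -/
theorem hasSum_tau_three_prime_pow {q : ℕ} (hq : q.Prime) {σ : ℝ} (hσ : 0 < σ) :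
    HasSum (fun e : ℕ => tau 3 (q ^ e) * ((q ^ e : ℕ) : ℝ) ^ (-σ))
      (1 / (1 - (q : ℝ) ^ (-σ)) ^ 3) := by
  have hq2 : (2 : ℝ) ≤ q := by exact_mod_cast hq.two_le
  set x : ℝ := (q : ℝ) ^ (-σ) with hx
  have hx0 : 0 ≤ x := Real.rpow_nonneg (by linarith) _
  have hx1 : x < 1 := by
    rw [hx, Real.rpow_neg (by linarith), inv_lt_one_iff₀]
    exact Or.inr (Real.one_lt_rpow (by linarith) hσ)
  have hxn : ‖x‖ < 1 := by rw [Real.norm_of_nonneg hx0]; exact hx1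
  have key := hasSum_choose_mul_geometric_of_norm_lt_one 2 hxn
  refine key.congr_fun fun e => ?_
  have hloc : ((q ^ e : ℕ) : ℝ) ^ (-σ) = x ^ e := by
    rw [hx, Nat.cast_pow, ← Real.rpow_natCast, ← Real.rpow_mul (by linarith), mul_comm,
      Real.rpow_mul (by linarith), Real.rpow_natCast]
  rw [hloc, tau_three_prime_pow hq]

/-- `(1 − x)⁻³ ≤ 1 + 124x` for `0 ≤ x ≤ 0.71` (`(1−x)³ ≥ 0.29³`). [folklore] -/
private theorem one_div_one_sub_cube_le {x : ℝ} (hx0 : 0 ≤ x) (hx : x ≤ 0.71) :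
    1 / (1 - x) ^ 3 ≤ 1 + 124 * x := by
  have h1 : (0.29 : ℝ) ≤ 1 - x := by linarith
  have h3 : (0.29 : ℝ) ^ 3 ≤ (1 - x) ^ 3 := pow_le_pow_left₀ (by norm_num) h1 3
  have hpos : 0 < (1 - x) ^ 3 := lt_of_lt_of_le (by norm_num) h3
  rw [div_le_iff₀ hpos]
  have h4 : 0 ≤ x * ((1 - x) ^ 3 - 0.29 ^ 3) := mul_nonneg hx0 (by linarith)
  have h5 : 0 ≤ x ^ 2 * (3 - x) := mul_nonneg (sq_nonneg x) (by linarith)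
  nlinarith

/-- For a prime `q` and `σ ≥ 1/2`: `q^{−σ} ≤ 2^{−1/2} ≤ 0.71`. [folklore] -/
private theorem prime_rpow_neg_le {q : ℕ} (hq : q.Prime) {σ : ℝ} (hσ : 1 / 2 ≤ σ) :
    (q : ℝ) ^ (-σ) ≤ 0.71 := by
  have hq2 : (2 : ℝ) ≤ q := by exact_mod_cast hq.two_le
  have h1 : (q : ℝ) ^ (-σ) ≤ (2 : ℝ) ^ (-σ) := by
    rw [Real.rpow_neg (by linarith), Real.rpow_neg (by norm_num)]
    exact inv_anti₀ (Real.rpow_pos_of_pos (by norm_num) _)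
      (Real.rpow_le_rpow (by norm_num) hq2 (by linarith))
  have h2 : (2 : ℝ) ^ (-σ) ≤ (2 : ℝ) ^ (-(1 / 2 : ℝ)) :=
    Real.rpow_le_rpow_of_exponent_le (by norm_num) (by linarith)
  have h3 : (2 : ℝ) ^ (-(1 / 2 : ℝ)) ≤ 0.71 := by
    rw [Real.rpow_neg (by norm_num), ← Real.sqrt_eq_rpow]
    have hs : (1.41 : ℝ) ≤ Real.sqrt 2 := Real.le_sqrt_of_sq_le (by norm_num)
    calc (Real.sqrt 2)⁻¹ ≤ (1.41 : ℝ)⁻¹ := inv_anti₀ (by norm_num) hs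
      _ ≤ 0.71 := by norm_num
  linarith

set_option maxHeartbeats 400000 in
/-- **The `𝔫(S)`-sum as a bounded Euler product**: for a finite set `S` and `σ ≥ 1/2`,
`Σ_{h∈𝔫(S)} τ₃(h)h^{−σ} ≤ ∏_{q∈S prime}(1 + 124·q^{−σ})` (local factors `(1 − q^{−σ})⁻³ ≤ 1 + 124q^{−σ}`).
[cite: Zhang2022LandauSiegel, §15 (15.9) p. 82] -/
theorem tsum_indicator_factoredNumbers_tau_three_le (S : Finset ℕ) {σ : ℝ} (hσ : 1 / 2 ≤ σ) :
    ∑' h : ℕ, (Nat.factoredNumbers S).indicator (fun h : ℕ => tau 3 h * (h : ℝ) ^ (-σ)) h ≤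
      ∏ q ∈ S.filter Nat.Prime, (1 + 124 * (q : ℝ) ^ (-σ)) := by
  have hσ0 : 0 < σ := by linarith
  set F : ℕ → ℝ := fun h => tau 3 h * (h : ℝ) ^ (-σ) with hF
  have hF1 : F 1 = 1 := by
    simp only [hF, MeanSquareMajorant.tau_apply_one, Nat.cast_one, Real.one_rpow, mul_one]
  have hmul : ∀ {a b : ℕ}, Nat.Coprime a b → F (a * b) = F a * F b := fun {a b} hab => by
    simp only [hF]
    rw [(MeanSquareMajorant.isMultiplicative_tau 3).map_mul_of_coprime hab, Nat.cast_mul,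
      Real.mul_rpow (Nat.cast_nonneg a) (Nat.cast_nonneg b)]
    ring
  have hF0 : ∀ h, 0 ≤ F h := fun h => mul_nonneg (MeanSquareMajorant.tau_nonneg _ _)
    (Real.rpow_nonneg (Nat.cast_nonneg _) _)
  have hsum : ∀ {q : ℕ}, q.Prime → Summable fun e : ℕ => ‖F (q ^ e)‖ := by
    intro q hq
    refine ((hasSum_tau_three_prime_pow hq hσ0).summable).congr fun e => ?_
    rw [Real.norm_of_nonneg (hF0 _)]
  have key := (EulerProduct.summable_and_hasSum_factoredNumbers_prod_filter_prime_tsum hF1 hmul hsum S).2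
  rw [(hasSum_subtype_iff_indicator.mp key).tsum_eq]
  refine Finset.prod_le_prod (fun q _ => tsum_nonneg fun e => hF0 _) fun q hq => ?_
  have hqp : q.Prime := (Finset.mem_filter.mp hq).2
  rw [(hasSum_tau_three_prime_pow hqp hσ0).tsum_eq]
  exact one_div_one_sub_cube_le (Real.rpow_nonneg (Nat.cast_nonneg _) _) (prime_rpow_neg_le hqp hσ)

/-- **`‖κ̃₁(d₁;r,s)‖ ≤ τ₃(d₁)·exp(124(e(log 16L + 4) + 1))`** for `L ≥ 1`, `log d₁ ≤ 3L⁹`, `Re s ≥ 1 − 1/(16L)`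
(in the §15.u021 use: `L = 𝓛`, `d₁ < 2P₄`): the `τ₃(d₁)`-times-polylog sup-bound of the `κ̃₁`-factor of the
(15.10) integrand on the `DeltaContourShift` region, from `norm_kappaTilde1_le` at `σ₀ = 1 − 1/(16L)`, the Euler
product above, and `EulerWeightPolylog.prod_primeFactors_one_add_mul_rpow_neg_le`.
[cite: Zhang2022LandauSiegel, §15 (15.9)–(15.10) p. 82] -/
theorem norm_kappaTilde1_le_exp (c' : ℝ) {D : ℕ} (χ : DirichletCharacter ℂ D) {d₁ : ℕ} (hd₁ : d₁ ≠ 0)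
    (r : ℕ) {L : ℝ} (hL : 1 ≤ L) (hlog : Real.log d₁ ≤ 3 * L ^ 9) (s : ℂ)
    (hs : 1 - 1 / (16 * L) ≤ s.re) :
    ‖kappaTilde1 c' χ d₁ r s‖ ≤
      tau 3 d₁ * Real.exp (124 * (Real.exp 1 * (Real.log (16 * L) + 4) + 1)) := by
  set σ₀ : ℝ := 1 - 1 / (16 * L) with hσ₀
  have hσhalf : 1 / 2 ≤ σ₀ := by
    rw [hσ₀]
    have : 1 / (16 * L) ≤ 1 / 16 := by
      rw [div_le_div_iff_of_pos_left (by norm_num) (by positivity) (by norm_num)]; linarith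
    linarith
  have hσ0 : 0 < σ₀ := by linarith
  have h1 := norm_kappaTilde1_le c' χ hd₁ r hσ0 s hs
  have h2 := tsum_indicator_factoredNumbers_tau_three_le d₁.primeFactors hσhalf
  have hfilter : d₁.primeFactors.filter Nat.Prime = d₁.primeFactors :=
    Finset.filter_true_of_mem fun q hq => Nat.prime_of_mem_primeFactors hq
  rw [hfilter] at h2
  have h3 := EulerWeightPolylog.prod_primeFactors_one_add_mul_rpow_neg_le (c := 124) hL (le_refl σ₀)
    (by norm_num) hd₁ hlog
  exact h1.trans (mul_le_mul_of_nonneg_left (h2.trans h3) (MeanSquareMajorant.tau_nonneg _ _))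

end Literature.NumberTheory.LFunctions.Zhang2022.Typed.Section15A
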